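import Summits.BirchSwinnertonDyer.Rank1Residual.WAll.TargetCMTwoRamifiedSMinus
import Summits.BirchSwinnertonDyer.Rank1Residual.X12.CMIsogenyInvariance
import Literature.NumberTheory.EllipticCurves.ShuZhai2021.Base256c1
import HarnessLib
import HarnessLib.Audit.Tags

/-!
# Rung W-ALL of ladder BSD (D-0120) — the ramified slice of row 12₂: THE SHU–ZHAI TWISTS OF `256c1`
# (`y² = x³ + 2p²M²x`) CARVED OUT OF THE RESIDUAL OF THE CONGRUENT-NUMBER ROADS, BY NAME
# (cell `bsd-print-cf2`, D-0131 (2) PRINT TIER, seat p2; crux stmt-BirchSwinnertonDyer-20509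
# `RamifiedOffTYZOfFacts` of route `PrintCf2`)

HONEST FRAMING (cell `bsd-print-cf2`, run/shared/lean/pub/bsd-print-cf2/; partition leaf «CornerF @ `p = 2`»
= `Summit.BirchSwinnertonDyer.WAllCornerFTwo`, OPEN AS A CLASS): STATEMENTS AND BOOKKEEPING ONLY — nothing
asserted, nothing booked, no named fact introduced, no published theorem restated. The ramified slice
`WAllCornerFTwoRamified` (CM, `ord_{s=1} L(E,s) = 1`, `2` ramified in `K ∈ {ℚ(i), ℚ(√−2)}`) is cut by the
congruent-number families of the p1 road (`WAll/TargetCMTwoRamifiedFamilies.lean`, `…OffTYZProved.lean`) and by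
Monsky's `𝒮⁻` (`WAll/TargetCMTwoRamifiedSMinus.lean`); the named residual of crux 20509 after those cuts is
`WAllCornerFTwoRamifiedOffTYZOffSMinus` (five-way) / `WAllCornerFTwoRamifiedOffTYZProvedOffSMinus` (flag-free
road). Every member of every family carved out so far is a `ℚ`-model of some `E_n : y² = x³ − n²x`; the
residual also contains the «virgin» quartic twists `y² = x³ + Ax`, `−A ∉ ℤ²` (ty2's model atlas,
`P2/CornerFTwoModelOffTYZ.lean`), on which ONE printed theorem applies (lit g3, DOSSIER §16): Shu–Zhai 2021
(Crelle 775) Thm 1.2 + Thm 1.4 (= Thm 4.10) at the optimal CM base `E₀ = 256c1 : y² = x³ + 2x` (`j = 1728`,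
`K = ℚ(i)`, `2` RAMIFIED; Cremona Table 1: optimal, `E₀(ℚ) ≅ ℤ/2`; Table 4: `L(E₀,1)/Ω = 1/2`, so
`f([0]) = (0,0) ∉ 2E₀(ℚ)` — tree fact `ShuZhai2021.base256c1_optimal_cuspZero`, p548891): for every prime
`p ≡ 7 (mod 8)` and every product `M` of an EVEN number of distinct primes `≡ 5 (mod 8)` (admissible: inert in
`ℚ(E₀[2]) = ℚ(√−2)` and `ℚ(E₀′[2]) = ℚ(√2)`; `M ≡ 1 (mod 8)` splits `2` in `ℚ(√M)`), the twist
`E₀^{(−pM)} : y² = x³ + 2p²M²x` has `ord_{s=1} L = rank = 1`, `Ш` finite of odd order, `ord₂(L′/ΩR) = 2k`, and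
satisfies BSD(·,2) (transported from `BSD(E₀,2)` = CM rank zero, row C8).

This file NAMES that family and carves it out, flag-free: §1 membership predicates
`P2.IsShuZhaiTwoFiftySixTwist` (ℚ-models of `256c1^{(−pM)}`) and `P2.IsIsogenousToShuZhaiTwoFiftySixTwist`
(their `ℚ`-isogeny classes; Cassels' invariance is conjunct 3 of `𝔅_ram`); §2 placement — CM by `ℤ[i]`, `2`
ramified, and no member model is a model of any `E_n` (disjoint from all four congruent-number family
predicates); §3 the leaf `WAllCornerFTwoRamifiedShuZhaiTwoFiftySix` and the residuals
`WAllCornerFTwoRamifiedOffTYZOffSMinusOffShuZhai` (six-way) / `WAllCornerFTwoRamifiedOffTYZProvedOffSMinusOffShuZhai`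
(flag-free road); §4 glue (excluded middle on membership; every cut EXACT). The CLOSER granted the named facts BY
NAME (Shu–Zhai Thm 1.2 / 1.4, Cassels, row C8, modularity, ARS06 Thm 2.6, `base256c1_optimal_cuspZero`) is
`PrintCf2.wAllCornerFTwoRamifiedShuZhaiTwoFiftySix_of_facts` (seat p2, `Theorems/PrintCf2RamifiedShuZhaiTwoFiftySixLeaf.lean`),
on ty2's setting file `P2/ShuZhaiTwoFiftySixCurve.lean` and p2's `P2/ShuZhaiCMBaseTransport.lean`.

WHY (seat p2, «2-descent matrix road … + Coates–Li–Tian–Zhai 2015 / Zhao 2-adic valuation of L(E,1)/Ω ⇒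
2-part of BSD family-wide»): Shu–Zhai 2021 is the rank-ONE sequel of CLTZ15 — a `2`-isogeny descent controlled
by admissible primes plus Zhao's induction on `2`-adic valuations (of Heegner points, via the generalized Birch
lemma) — read on the one CM base with `2` ramified that its printed hypotheses admit. beyond-print theorem: NO
(this IS print); PARTITION: the sub-cell «`y² = x³ + 2p²M²x`» of crux 20509's quartic residual moves from NO
PRINT to IN PRINT (by name, TABLE-COMPOSITE-conditional on `base256c1_optimal_cuspZero`).

References: `WAll/TargetCMTwoRamifiedFamilies.lean` (p533515), `WAll/TargetCMTwoRamifiedOffTYZProved.lean`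
(p536500), `WAll/TargetCMTwoRamifiedSMinus.lean` (p544597), `P2/CornerFTwoModelOffTYZ.lean` (ty2, p542560),
`X12/CMIsogenyInvariance.lean`, `Literature/…/ShuZhai2021/Base256c1.lean` (lit g3, p548891), route file
`Summits/BirchSwinnertonDyer/BirchSwinnertonDyer/Theses/PrintCf2.lean` (item 20509); cell dossier
run/shared/lean/pub/bsd-print-cf2/DOSSIER.md §16. [cite: ShuZhai2021, Thm. 1.2, Thm. 1.4, Thm. 4.10
(arXiv:2102.11808 chunks p0003 L24–L45, p0013 L14–L26)] [cite: Cremona1997, Table 1 (N = 256, curve C1) and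
Table 4 (row 256C)] [cite: MilneADT2006, Thm. I.7.3] [cite: Miller2011LMS, §1 and Def. 1.1] (the currency
`BSD(E,p)`).
-/

noncomputable section

open scoped Classical

open WeierstrassCurve Literature.NumberTheory.EllipticCurves
  Literature.NumberTheory.EllipticCurves.Rank1Residual
  Literature.NumberTheory.EllipticCurves.ShuZhai2021
open Summit.BirchSwinnertonDyer.Rank1Residual

set_option autoImplicit false

/-! ### §1. Membership predicates: the Shu–Zhai twists of `256c1` and their `ℚ`-isogeny classes -/

namespace Summit.BirchSwinnertonDyer.Rank1Residual.P2

/-- **`W` is a `ℚ`-model of an explicit Shu–Zhai twist of `256c1`**: there are a prime `p ≡ 7 (mod 8)`, a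
finite set `Q` of primes `≡ 5 (mod 8)` of EVEN cardinality (`#Q % 2 = 0`, i.e. `M = ∏_{q∈Q} q ≡ 1 (mod 8)`:
hypothesis (ii) of Thm 1.4 at `ℚ(√M)`, ty2's `allPrimesSplitInSqrt_two_mul_conductorNorm_prod_curve256c1`), and a
`ℚ`-isomorphism `C • 256c1^{(−p∏q)} = W` (`256c1^{(d)} = curve256c1.quadraticTwist d = y² = x³ + 2d²x`). A
definition with a body (data `p`, `Q`, `C`), not a named fact. [cite: ShuZhai2021, Thm. 1.2, Def. 1.1 and Thm. 1.4 (ii)] -/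
def IsShuZhaiTwoFiftySixTwist (W : WeierstrassCurve ℚ) : Prop :=
  ∃ (p : ℕ) (Q : Finset ℕ) (C : VariableChange ℚ), p.Prime ∧ p % 8 = 7 ∧
    (∀ q ∈ Q, q.Prime ∧ q % 8 = 5) ∧ Q.card % 2 = 0 ∧
    C • curve256c1.quadraticTwist (-((p * ∏ q ∈ Q, q : ℕ) : ℚ)) = W

/-- **`W` is `ℚ`-ISOGENOUS to an explicit Shu–Zhai twist of `256c1`** (same parameters `p`, `Q`): the
isogeny-class form of `IsShuZhaiTwoFiftySixTwist`; it contains every `ℚ`-model of `y² = x³ + 2p²M²x` and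
of its `2`-isogenous partner `y² = x³ − 8p²M²x` (`M = ∏ q`). A definition with a body (data `p`, `Q`).
[cite: ShuZhai2021, Thm. 1.2, Def. 1.1 and Thm. 1.4 (ii)] -/
def IsIsogenousToShuZhaiTwoFiftySixTwist (W : WeierstrassCurve ℚ) : Prop :=
  ∃ (p : ℕ) (Q : Finset ℕ), p.Prime ∧ p % 8 = 7 ∧ (∀ q ∈ Q, q.Prime ∧ q % 8 = 5) ∧
    Q.card % 2 = 0 ∧ IsIsogenous W (curve256c1.quadraticTwist (-((p * ∏ q ∈ Q, q : ℕ) : ℚ)))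

/-- The twist of `256c1` by `d` on the nose: `curve256c1.quadraticTwist d = ⟨0, 0, 0, 2d², 0⟩` (`y² = x³ + 2d²x`;
`b₂ = b₆ = 0`, `b₄ = 4`). Private copy (the public statement is ty2's `P2.quadraticTwist_curve256c1` in
`P2/ShuZhaiTwoFiftySixCurve.lean`, not imported here to keep this statement file upstream of the setting file).
[cite: SilvermanAEC2009, X.5 Cor. 5.4] -/
private theorem twist256c1_eq_quartic (d : ℚ) :
    curve256c1.quadraticTwist d = (⟨0, 0, 0, 2 * d ^ 2, 0⟩ : WeierstrassCurve ℚ) := by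
  ext
  · simp [curve256c1, quadraticTwist]
  · simp [curve256c1, quadraticTwist, WeierstrassCurve.b₂]
  · simp [curve256c1, quadraticTwist]
  · simp [curve256c1, quadraticTwist, WeierstrassCurve.b₄]; ring
  · simp [curve256c1, quadraticTwist, WeierstrassCurve.b₆]

/-- The parameter `p · ∏ q` of a member is a nonzero natural. [folklore] -/
theorem mul_prod_ne_zero_of_prime {p : ℕ} (hp : p.Prime) {Q : Finset ℕ} (hQ : ∀ q ∈ Q, q.Prime ∧ q % 8 = 5) :
    p * ∏ q ∈ Q, q ≠ 0 :=
  Nat.pos_iff_ne_zero.mp (Nat.mul_pos hp.pos (Finset.prod_pos fun q hq => (hQ q hq).1.pos))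

/-- The `r = 0` members: every `ℚ`-model of `256c1^{(−p)} : y² = x³ + 2p²x`, `p ≡ 7 (mod 8)` prime, is in
the family (`Q = ∅`). [cite: ShuZhai2021, Thm. 1.2 (r = 0)] -/
theorem isShuZhaiTwoFiftySixTwist_of_prime {p : ℕ} (hp : p.Prime) (h8 : p % 8 = 7)
    {W : WeierstrassCurve ℚ} {C : VariableChange ℚ} (hC : C • curve256c1.quadraticTwist (-(p : ℚ)) = W) :
    IsShuZhaiTwoFiftySixTwist W :=
  ⟨p, ∅, C, hp, h8, fun q hq => absurd hq (Finset.notMem_empty q), by simp, by simpa using hC⟩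

/-- Models are isogenous (an isomorphism is an isogeny). [cite: SilvermanAEC2009, III.4] -/
theorem isIsogenousToShuZhaiTwoFiftySixTwist_of_isShuZhaiTwoFiftySixTwist {W : WeierstrassCurve ℚ}
    (hW : IsShuZhaiTwoFiftySixTwist W) : IsIsogenousToShuZhaiTwoFiftySixTwist W := by
  obtain ⟨p, Q, C, hp, h8, hQ, hM, hC⟩ := hW
  exact ⟨p, Q, hp, h8, hQ, hM, isIsogenous_of_smul_eq' hC⟩

/-! ### §2. Placement: CM by `ℤ[i]`, `2` ramified; no member model is a model of any `E_n` -/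

/-- Every elliptic `ℚ`-model of a twist of `256c1` has CM with `2` RAMIFIED in `K = ℚ(i)` (the twist is
`y² = x³ + 2d²x`, `j = 1728`; ty2's `CornerFTwo.hasCM_and_cmRamified_two_of_smul_quartic`). Private copy of ty2's
`P2.hasCM_and_cmRamified_two_of_smul_twist_curve256c1` (setting file, not imported here).
[cite: Cox2013, §5.B Prop. 5.16 and Cor. 5.17] -/
private theorem hasCM_and_cmRamified_two_of_model_twist256c1 {d : ℚ} (hd : d ≠ 0) {W : WeierstrassCurve ℚ}
    [W.IsElliptic] {C : VariableChange ℚ} (hC : C • curve256c1.quadraticTwist d = W) :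
    W.HasCM ∧ CMRamified W 2 := by
  rw [twist256c1_eq_quartic] at hC
  exact CornerFTwo.hasCM_and_cmRamified_two_of_smul_quartic (mul_ne_zero two_ne_zero (pow_ne_zero 2 hd)) hC

/-- **Every elliptic `W` `ℚ`-ISOGENOUS to a twist of `256c1` has CM with `2` RAMIFIED in its CM field** (CM
and the CM field are `ℚ`-isogeny invariants: `X12.hasCM_of_isIsogenous`, `X12.cmRamified_iff_of_isIsogenous`).
[cite: SilvermanAEC2009, Cor. III.9.4 and III.6] -/
theorem hasCM_and_cmRamified_two_of_isIsogenous_twist_curve256c1 {d : ℚ} (hd : d ≠ 0)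
    (W : WeierstrassCurve ℚ) [W.IsElliptic] (hiso : IsIsogenous W (curve256c1.quadraticTwist d)) :
    W.HasCM ∧ CMRamified W 2 := by
  haveI := isElliptic_curve256c1
  haveI := curve256c1.isElliptic_quadraticTwist hd
  obtain ⟨hT, hTram⟩ := hasCM_and_cmRamified_two_of_model_twist256c1 hd
    (show (1 : VariableChange ℚ) • curve256c1.quadraticTwist d = _ from one_smul _ _)
  have hcmW : W.HasCM := X12.hasCM_of_isIsogenous hiso.symm_of_charZero hT
  exact ⟨hcmW, (X12.cmRamified_iff_of_isIsogenous hiso hcmW 2).2 hTram⟩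

/-- **Placement of the family (models)**: every elliptic `ℚ`-model of a member has CM and `2` ramified in
`K` — it lies in the ramified slice `WAllCornerFTwoRamified` of row 12₂ (analytic rank one is Shu–Zhai's
Thm 1.2, not used here). [cite: ShuZhai2021, Thm. 1.2] [cite: Cox2013, §5.B Prop. 5.16] -/
theorem hasCM_and_cmRamified_two_of_isShuZhaiTwoFiftySixTwist (W : WeierstrassCurve ℚ) [W.IsElliptic]
    (hW : IsShuZhaiTwoFiftySixTwist W) : W.HasCM ∧ CMRamified W 2 := by
  obtain ⟨p, Q, C, hp, -, hQ, -, hC⟩ := hW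
  exact hasCM_and_cmRamified_two_of_model_twist256c1
    (neg_ne_zero.mpr (by exact_mod_cast mul_prod_ne_zero_of_prime hp hQ)) hC

/-- **Placement of the family (isogeny classes)**: CM and `2` ramified in the CM field.
[cite: SilvermanAEC2009, Cor. III.9.4] -/
theorem hasCM_and_cmRamified_two_of_isIsogenousToShuZhaiTwoFiftySixTwist (W : WeierstrassCurve ℚ)
    [W.IsElliptic] (hW : IsIsogenousToShuZhaiTwoFiftySixTwist W) : W.HasCM ∧ CMRamified W 2 := by
  obtain ⟨p, Q, hp, -, hQ, -, hiso⟩ := hW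
  exact hasCM_and_cmRamified_two_of_isIsogenous_twist_curve256c1
    (neg_ne_zero.mpr (by exact_mod_cast mul_prod_ne_zero_of_prime hp hQ)) W hiso

/-- **No `ℚ`-model of a twist `256c1^{(d)}`, `d ∈ ℤ ∖ {0}`, is a `ℚ`-model of a congruent-number curve
`E_m`**: such a `W` is a model of `y² = x³ + Ax` with `A = 2d²`, and a common model with `E_m` would force
`−A = −2d² ∈ ℤ²` (ty2's `Atlas.isSquare_neg_of_smul_quartic_of_smul_congruentNumberCurve`), absurd for `d ≠ 0`.
[cite: SilvermanAEC2009, X.5 Prop. 5.4 (ii) and X.6 Prop. 6.1] -/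
theorem not_smul_congruentNumberCurve_of_smul_twist_curve256c1 {d : ℤ} (hd : d ≠ 0) {W : WeierstrassCurve ℚ}
    {C : VariableChange ℚ} (hC : C • curve256c1.quadraticTwist (d : ℚ) = W) (m : ℕ) (C' : VariableChange ℚ) :
    C' • congruentNumberCurve m ≠ W := by
  intro hC'
  rw [twist256c1_eq_quartic] at hC
  have hA : C • (⟨0, 0, 0, ((2 * d ^ 2 : ℤ) : ℚ), 0⟩ : WeierstrassCurve ℚ) = W := by
    push_cast; exact hC
  obtain ⟨r, hr⟩ := CornerFTwo.Atlas.isSquare_neg_of_smul_quartic_of_smul_congruentNumberCurve hA hC'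
  have hd2 : 0 < d ^ 2 := by positivity
  nlinarith [mul_self_nonneg r]

/-- The twisting parameter of a member as an integer: `−(p∏q : ℕ) = ((−(p∏q) : ℤ) : ℚ)`. [folklore] -/
theorem neg_natCast_eq_intCast (n : ℕ) : (-(n : ℚ)) = ((-(n : ℤ) : ℤ) : ℚ) := by push_cast; ring

/-- **No `ℚ`-model of a member of the Shu–Zhai `256c1` family is a model of any `E_m`.**
[cite: SilvermanAEC2009, X.5 Prop. 5.4 (ii)] -/
theorem not_smul_congruentNumberCurve_of_isShuZhaiTwoFiftySixTwist {W : WeierstrassCurve ℚ}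
    (hW : IsShuZhaiTwoFiftySixTwist W) (m : ℕ) (C' : VariableChange ℚ) : C' • congruentNumberCurve m ≠ W := by
  obtain ⟨p, Q, C, hp, -, hQ, -, hC⟩ := hW
  rw [neg_natCast_eq_intCast] at hC
  exact not_smul_congruentNumberCurve_of_smul_twist_curve256c1
    (neg_ne_zero.mpr (by exact_mod_cast mul_prod_ne_zero_of_prime hp hQ)) hC m C'

/-- Every member of the U⁺-road TYZ families is a `ℚ`-model of some `E_m` (read off the three disjuncts).
[folklore] -/
theorem exists_smul_congruentNumberCurve_of_congruentTYZUPlusFamily {W : WeierstrassCurve ℚ} [W.IsElliptic]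
    [W.IsGloballyMinimal] (h : CongruentTYZUPlusFamily W) :
    ∃ (m : ℕ) (C : VariableChange ℚ), C • congruentNumberCurve m = W := by
  rcases h with ⟨k, p, -, -, -, -, -, C, hC⟩ | ⟨n, -, -, -, C, hC⟩ | ⟨p, -, -, -, -, C, hC⟩
  · exact ⟨_, C, hC⟩
  · exact ⟨n, C, hC⟩
  · exact ⟨_, C, hC⟩

/-- Every member of the `ω = 3` FJ atlas is a `ℚ`-model of some `E_m`. [folklore] -/
theorem exists_smul_congruentNumberCurve_of_congruentTYZAtlasFJFamily {W : WeierstrassCurve ℚ} [W.IsElliptic]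
    [W.IsGloballyMinimal] (h : CongruentTYZAtlasFJFamily W) :
    ∃ (m : ℕ) (C : VariableChange ℚ), C • congruentNumberCurve m = W := by
  obtain ⟨p, -, -, -, -, -, C, hC⟩ := h
  exact ⟨_, C, hC⟩

/-- Every member of Monsky's `𝒮⁻` is a `ℚ`-model of some `E_m`. [folklore] -/
theorem exists_smul_congruentNumberCurve_of_congruentMonskySMinusFamily {W : WeierstrassCurve ℚ} [W.IsElliptic]
    [W.IsGloballyMinimal] (h : CongruentMonskySMinusFamily W) :
    ∃ (m : ℕ) (C : VariableChange ℚ), C • congruentNumberCurve m = W := by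
  obtain ⟨p, q, -, -, -, -, -, C, hC⟩ := h
  exact ⟨_, C, hC⟩

/-- **The Shu–Zhai `256c1` family (models) is DISJOINT from all four congruent-number family predicates of the
ramified cuts** — `CongruentTYZProvedFamily`, `CongruentTYZUPlusFamily`, `CongruentTYZAtlasFJFamily`,
`CongruentMonskySMinusFamily` — each of whose members is a model of some `E_m`. [cite: SilvermanAEC2009, X.5 Prop. 5.4 (ii)] -/
theorem not_congruentFamilies_of_isShuZhaiTwoFiftySixTwist {W : WeierstrassCurve ℚ} [W.IsElliptic]
    [W.IsGloballyMinimal] (hW : IsShuZhaiTwoFiftySixTwist W) :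
    ¬ CongruentTYZProvedFamily W ∧ ¬ CongruentTYZUPlusFamily W ∧ ¬ CongruentTYZAtlasFJFamily W ∧
      ¬ CongruentMonskySMinusFamily W := by
  refine ⟨fun h => ?_, fun h => ?_, fun h => ?_, fun h => ?_⟩
  · obtain ⟨m, -, C', hC'⟩ := CornerFTwo.exists_smul_congruentNumberCurve_of_congruentTYZProvedFamily h
    exact not_smul_congruentNumberCurve_of_isShuZhaiTwoFiftySixTwist hW m C' hC'
  · obtain ⟨m, C', hC'⟩ := exists_smul_congruentNumberCurve_of_congruentTYZUPlusFamily h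
    exact not_smul_congruentNumberCurve_of_isShuZhaiTwoFiftySixTwist hW m C' hC'
  · obtain ⟨m, C', hC'⟩ := exists_smul_congruentNumberCurve_of_congruentTYZAtlasFJFamily h
    exact not_smul_congruentNumberCurve_of_isShuZhaiTwoFiftySixTwist hW m C' hC'
  · obtain ⟨m, C', hC'⟩ := exists_smul_congruentNumberCurve_of_congruentMonskySMinusFamily h
    exact not_smul_congruentNumberCurve_of_isShuZhaiTwoFiftySixTwist hW m C' hC'

end Summit.BirchSwinnertonDyer.Rank1Residual.P2

namespace Summit.BirchSwinnertonDyer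

/-! ### §3. Leaves: the Shu–Zhai `256c1` slice and the residuals off it -/

/-- **Ramified slice ON THE `ℚ`-ISOGENY CLASSES OF THE SHU–ZHAI TWISTS OF `256c1`** (closed granted named facts
BY NAME by `PrintCf2.wAllCornerFTwoRamifiedShuZhaiTwoFiftySix_of_facts`: Shu–Zhai 2021 Thm 1.2 / 1.4 at the
base `256c1`, Cassels, row C8, modularity, ARS06 Thm 2.6, `base256c1_optimal_cuspZero`): CM,
`ord_{s=1} L(E,s) = 1`, `2 ∣ d_K`, `W` `ℚ`-isogenous to some `256c1^{(−p∏q)}` ⇒ `BSD(E,2)`. [folklore] -/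
@[conjecture] def WAllCornerFTwoRamifiedShuZhaiTwoFiftySix : Prop :=
  ∀ (W : WeierstrassCurve ℚ) [W.IsElliptic] [W.IsGloballyMinimal],
    W.HasCM → W.analyticRank = 1 → CMRamified W 2 → P2.IsIsogenousToShuZhaiTwoFiftySixTwist W → BSDp W 2

/-- **Six-way residual: OFF the three TYZ family predicates, OFF `𝒮⁻` AND OFF the Shu–Zhai `256c1` classes
(OPEN)** — the five-way residual `WAllCornerFTwoRamifiedOffTYZOffSMinus` with the Shu–Zhai twists of `256c1`
carved out as well. Still contains every `E_m` off the families (`s(m) ≥ 3`; `s(m) = 1` with even genus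
sums), every quartic twist `y² = x³ + Ax` (`−A ∉ ℤ²`) off the classes `{2p²M², −8p²M²}·ℚˣ⁴`, every
`j = 287496` and every `j = 8000` curve of analytic rank one. No theorem in print. [folklore] -/
@[conjecture] def WAllCornerFTwoRamifiedOffTYZOffSMinusOffShuZhai : Prop :=
  ∀ (W : WeierstrassCurve ℚ) [W.IsElliptic] [W.IsGloballyMinimal],
    W.HasCM → W.analyticRank = 1 → CMRamified W 2 →
      ¬ CongruentTYZProvedFamily W → ¬ CongruentTYZUPlusFamily W → ¬ CongruentTYZAtlasFJFamily W →
      ¬ CongruentMonskySMinusFamily W → ¬ P2.IsIsogenousToShuZhaiTwoFiftySixTwist W → BSDp W 2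

/-- **Flag-free residual OFF the proved TYZ families, OFF `𝒮⁻` AND OFF the Shu–Zhai `256c1` classes (OPEN)**
— the residual of the FLAG-FREE roads of route `PrintCf2` inside crux 20509 after the three by-name carve-outs
(`WAllCornerFTwoRamifiedOffTYZProvedOffSMinus` minus the Shu–Zhai classes). Still contains the U⁺-road /
FJ-atlas leaves. No theorem in print. [folklore] -/
@[conjecture] def WAllCornerFTwoRamifiedOffTYZProvedOffSMinusOffShuZhai : Prop :=
  ∀ (W : WeierstrassCurve ℚ) [W.IsElliptic] [W.IsGloballyMinimal],
    W.HasCM → W.analyticRank = 1 → CMRamified W 2 → ¬ CongruentTYZProvedFamily W →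
      ¬ CongruentMonskySMinusFamily W → ¬ P2.IsIsogenousToShuZhaiTwoFiftySixTwist W → BSDp W 2

/-! ### §4. Glue (excluded middle on membership only; every cut exact) -/

/-- **The five-way residual ⟺ its Shu–Zhai part ∧ the six-way residual** (EXACT; pure logic), the Shu–Zhai
part spelled out with the four non-membership binders. [folklore] -/
theorem wAllCornerFTwoRamifiedOffTYZOffSMinus_iff_onShuZhai_offShuZhai :
    WAllCornerFTwoRamifiedOffTYZOffSMinus ↔
      (∀ (W : WeierstrassCurve ℚ) [W.IsElliptic] [W.IsGloballyMinimal],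
          W.HasCM → W.analyticRank = 1 → CMRamified W 2 → ¬ CongruentTYZProvedFamily W →
            ¬ CongruentTYZUPlusFamily W → ¬ CongruentTYZAtlasFJFamily W → ¬ CongruentMonskySMinusFamily W →
            P2.IsIsogenousToShuZhaiTwoFiftySixTwist W → BSDp W 2) ∧
      WAllCornerFTwoRamifiedOffTYZOffSMinusOffShuZhai := by
  constructor
  · intro h
    exact ⟨fun W _ _ hcm hr1 hram h1 h2 h3 h4 _ ↦ h W hcm hr1 hram h1 h2 h3 h4,
      fun W _ _ hcm hr1 hram h1 h2 h3 h4 _ ↦ h W hcm hr1 hram h1 h2 h3 h4⟩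
  · rintro ⟨hS, hO⟩ W _ _ hcm hr1 hram h1 h2 h3 h4
    by_cases h5 : P2.IsIsogenousToShuZhaiTwoFiftySixTwist W
    · exact hS W hcm hr1 hram h1 h2 h3 h4 h5
    · exact hO W hcm hr1 hram h1 h2 h3 h4 h5

/-- **The five-way residual from the Shu–Zhai `256c1` leaf and the six-way residual** — the registered residual
stub of crux 20509 REDUCES to the six-way residual once the Shu–Zhai leaf is closed. [folklore] -/
theorem wAllCornerFTwoRamifiedOffTYZOffSMinus_of_shuZhai_of_offShuZhai (hS : WAllCornerFTwoRamifiedShuZhaiTwoFiftySix)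
    (hO : WAllCornerFTwoRamifiedOffTYZOffSMinusOffShuZhai) : WAllCornerFTwoRamifiedOffTYZOffSMinus :=
  wAllCornerFTwoRamifiedOffTYZOffSMinus_iff_onShuZhai_offShuZhai.2
    ⟨fun W _ _ hcm hr1 hram _ _ _ _ h5 ↦ hS W hcm hr1 hram h5, hO⟩

/-- The six-way residual is a restriction of the five-way one. [folklore] -/
theorem wAllCornerFTwoRamifiedOffTYZOffSMinusOffShuZhai_of_offTYZOffSMinus (h : WAllCornerFTwoRamifiedOffTYZOffSMinus) :
    WAllCornerFTwoRamifiedOffTYZOffSMinusOffShuZhai :=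
  (wAllCornerFTwoRamifiedOffTYZOffSMinus_iff_onShuZhai_offShuZhai.1 h).2

/-- **The flag-free residual off `𝒮⁻` ⟺ its Shu–Zhai part ∧ the flag-free residual off the Shu–Zhai classes**
(EXACT; pure logic). [folklore] -/
theorem wAllCornerFTwoRamifiedOffTYZProvedOffSMinus_iff_onShuZhai_offShuZhai :
    WAllCornerFTwoRamifiedOffTYZProvedOffSMinus ↔
      (∀ (W : WeierstrassCurve ℚ) [W.IsElliptic] [W.IsGloballyMinimal],
          W.HasCM → W.analyticRank = 1 → CMRamified W 2 → ¬ CongruentTYZProvedFamily W →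
            ¬ CongruentMonskySMinusFamily W → P2.IsIsogenousToShuZhaiTwoFiftySixTwist W → BSDp W 2) ∧
      WAllCornerFTwoRamifiedOffTYZProvedOffSMinusOffShuZhai := by
  constructor
  · intro h
    exact ⟨fun W _ _ hcm hr1 hram h1 h4 _ ↦ h W hcm hr1 hram h1 h4,
      fun W _ _ hcm hr1 hram h1 h4 _ ↦ h W hcm hr1 hram h1 h4⟩
  · rintro ⟨hS, hO⟩ W _ _ hcm hr1 hram h1 h4
    by_cases h5 : P2.IsIsogenousToShuZhaiTwoFiftySixTwist W
    · exact hS W hcm hr1 hram h1 h4 h5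
    · exact hO W hcm hr1 hram h1 h4 h5

/-- The flag-free residual off `𝒮⁻` from the Shu–Zhai leaf and the flag-free residual off the Shu–Zhai
classes. [folklore] -/
theorem wAllCornerFTwoRamifiedOffTYZProvedOffSMinus_of_shuZhai_of_offShuZhai
    (hS : WAllCornerFTwoRamifiedShuZhaiTwoFiftySix) (hO : WAllCornerFTwoRamifiedOffTYZProvedOffSMinusOffShuZhai) :
    WAllCornerFTwoRamifiedOffTYZProvedOffSMinus :=
  wAllCornerFTwoRamifiedOffTYZProvedOffSMinus_iff_onShuZhai_offShuZhai.2
    ⟨fun W _ _ hcm hr1 hram _ _ h5 ↦ hS W hcm hr1 hram h5, hO⟩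

/-- The flag-free residual off the Shu–Zhai classes is a restriction of the one off `𝒮⁻`. [folklore] -/
theorem wAllCornerFTwoRamifiedOffTYZProvedOffSMinusOffShuZhai_of_offTYZProvedOffSMinus
    (h : WAllCornerFTwoRamifiedOffTYZProvedOffSMinus) : WAllCornerFTwoRamifiedOffTYZProvedOffSMinusOffShuZhai :=
  (wAllCornerFTwoRamifiedOffTYZProvedOffSMinus_iff_onShuZhai_offShuZhai.1 h).2

/-- **The flag-free residual off the Shu–Zhai classes ⟺ (U⁺-road leaf, restricted) ∧ (FJ-atlas leaf, restricted)
∧ the six-way residual** (EXACT; pure logic) — the LITERAL / closed sub-slices stay sub-slices of the new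
residual, by name. [folklore] -/
theorem wAllCornerFTwoRamifiedOffTYZProvedOffSMinusOffShuZhai_iff_uPlus_atlasFJ_off :
    WAllCornerFTwoRamifiedOffTYZProvedOffSMinusOffShuZhai ↔
      (∀ (W : WeierstrassCurve ℚ) [W.IsElliptic] [W.IsGloballyMinimal],
          W.HasCM → W.analyticRank = 1 → CMRamified W 2 → ¬ CongruentTYZProvedFamily W →
            ¬ CongruentMonskySMinusFamily W → ¬ P2.IsIsogenousToShuZhaiTwoFiftySixTwist W →
            CongruentTYZUPlusFamily W → BSDp W 2) ∧
      (∀ (W : WeierstrassCurve ℚ) [W.IsElliptic] [W.IsGloballyMinimal],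
          W.HasCM → W.analyticRank = 1 → CMRamified W 2 → ¬ CongruentTYZProvedFamily W →
            ¬ CongruentMonskySMinusFamily W → ¬ P2.IsIsogenousToShuZhaiTwoFiftySixTwist W →
            CongruentTYZAtlasFJFamily W → BSDp W 2) ∧
      WAllCornerFTwoRamifiedOffTYZOffSMinusOffShuZhai := by
  constructor
  · intro h
    exact ⟨fun W _ _ hcm hr1 hram hn hs hz _ ↦ h W hcm hr1 hram hn hs hz,
      fun W _ _ hcm hr1 hram hn hs hz _ ↦ h W hcm hr1 hram hn hs hz,
      fun W _ _ hcm hr1 hram hn _ _ hs hz ↦ h W hcm hr1 hram hn hs hz⟩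
  · rintro ⟨hU, hF, hO⟩ W _ _ hcm hr1 hram hn hs hz
    by_cases h2 : CongruentTYZUPlusFamily W
    · exact hU W hcm hr1 hram hn hs hz h2
    · by_cases h3 : CongruentTYZAtlasFJFamily W
      · exact hF W hcm hr1 hram hn hs hz h3
      · exact hO W hcm hr1 hram hn h2 h3 hs hz

/-- **The reshaped composition of crux `RamifiedOffTYZOfFacts`' skeleton**: U⁺-road leaf, FJ-atlas leaf, `𝒮⁻`
leaf, Shu–Zhai `256c1` leaf and the six-way residual together give the flag-free residual
`WAllCornerFTwoRamifiedOffTYZProved` (excluded middle only). [folklore] -/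
theorem wAllCornerFTwoRamifiedOffTYZProved_of_uPlus_of_atlasFJ_of_sMinus_of_shuZhai_of_off
    (hU : WAllCornerFTwoRamifiedTYZUPlus) (hF : WAllCornerFTwoRamifiedTYZAtlasFJ)
    (hS : WAllCornerFTwoRamifiedSMinus) (hZ : WAllCornerFTwoRamifiedShuZhaiTwoFiftySix)
    (hO : WAllCornerFTwoRamifiedOffTYZOffSMinusOffShuZhai) : WAllCornerFTwoRamifiedOffTYZProved :=
  wAllCornerFTwoRamifiedOffTYZProved_of_uPlus_of_atlasFJ_of_sMinus_of_offSMinus hU hF hS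
    (wAllCornerFTwoRamifiedOffTYZOffSMinus_of_shuZhai_of_offShuZhai hZ hO)

/-- The Shu–Zhai leaf is a restriction of the ramified slice … [folklore] -/
theorem wAllCornerFTwoRamifiedShuZhaiTwoFiftySix_of_wAllCornerFTwoRamified (h : WAllCornerFTwoRamified) :
    WAllCornerFTwoRamifiedShuZhaiTwoFiftySix :=
  fun W _ _ hcm hr1 hram _ ↦ h W hcm hr1 hram

/-- … and of row 12₂. [folklore] -/
theorem wAllCornerFTwoRamifiedShuZhaiTwoFiftySix_of_wAllCornerFTwo (h : WAllCornerFTwo) :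
    WAllCornerFTwoRamifiedShuZhaiTwoFiftySix :=
  wAllCornerFTwoRamifiedShuZhaiTwoFiftySix_of_wAllCornerFTwoRamified (wAllCornerFTwo_iff_slices.1 h).2.2.1

/-- The six-way residual follows from the ramified slice. [folklore] -/
theorem wAllCornerFTwoRamifiedOffTYZOffSMinusOffShuZhai_of_wAllCornerFTwoRamified (h : WAllCornerFTwoRamified) :
    WAllCornerFTwoRamifiedOffTYZOffSMinusOffShuZhai :=
  fun W _ _ hcm hr1 hram _ _ _ _ _ ↦ h W hcm hr1 hram

/-- **The ramified slice ⟺ ON the proved TYZ families ∧ ON `𝒮⁻` ∧ ON the Shu–Zhai `256c1` classes ∧ OFF all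
three** (EXACT) — the four-way flag-free cut the route `PrintCf2` can glue inside `𝔅_ram ∪ {SZ12, SZ14, ARS06,
base256c1}`. [folklore] -/
theorem wAllCornerFTwoRamified_iff_tyzProved_sMinus_shuZhai_off :
    WAllCornerFTwoRamified ↔ WAllCornerFTwoRamifiedTYZProved ∧ WAllCornerFTwoRamifiedSMinus ∧
      WAllCornerFTwoRamifiedShuZhaiTwoFiftySix ∧ WAllCornerFTwoRamifiedOffTYZProvedOffSMinusOffShuZhai := by
  constructor
  · intro h
    obtain ⟨hP, hS, hO⟩ := wAllCornerFTwoRamified_iff_tyzProved_sMinus_offSMinus.1 h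
    exact ⟨hP, hS, wAllCornerFTwoRamifiedShuZhaiTwoFiftySix_of_wAllCornerFTwoRamified h,
      wAllCornerFTwoRamifiedOffTYZProvedOffSMinusOffShuZhai_of_offTYZProvedOffSMinus hO⟩
  · rintro ⟨hP, hS, hZ, hO⟩
    exact wAllCornerFTwoRamified_iff_tyzProved_sMinus_offSMinus.2
      ⟨hP, hS, wAllCornerFTwoRamifiedOffTYZProvedOffSMinus_of_shuZhai_of_offShuZhai hZ hO⟩

end Summit.BirchSwinnertonDyer

end
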